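import Mathlib
import Summits.QuantumAdvantage.QuantumAdvantage.Theorems.MobiusLadderDigitPolyUniformityWalshGappedLemmas
import Summits.QuantumAdvantage.QuantumAdvantage.Theorems.MobiusLadderQuadraticDigitPhasesStubOneCutKataiCS

/-!
# Crux `DigitPolyUniformity` (stmt-QuantumAdvantage-1392), line `Sketch` (LAR composition):
# the low-affine class from averaged short-interval Walsh uniformity

Fix a cut `h(n) ≤ n` and split `N = 2^{h} y + x` (`x` = the low `h` binary digits of `N < 2ⁿ`,
`y` = the high `n − h` ones). HYPOTHESIS (short-interval Walsh uniformity of `λ` at scale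
`2^{h(n)}`, on average over the aligned intervals `[2^h y, 2^h (y+1))`, with the frequency set
allowed to depend on the interval): for every `ε > 0`, eventually in `n`, for every selection
`σ : y ↦ S_y ⊆ {0, …, h−1}`,

  `Σ_{y < 2^{n−h}} |Σ_{x < 2^h} λ(2^h y + x) w_{S_y}(x)| ≤ ε 2ⁿ`,  `w_S(x) = Π_{i ∈ S} (−1)^{bit_i x}`.

CONCLUSION (`digitPolyUniformity_lowAffine_of_shortWalsh`): the crux inequality
`|Σ_{N<2ⁿ} λ(N) (−1)^{P(bits N)}| ≤ ε 2ⁿ` for every `P ∈ 𝔽₂[x_0, …, x_{n−1}]` that is AFFINE IN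
THE LOW DIGITS with coefficients arbitrary functions of the high digits,
`P(bits N) = Σ_{i<h} bit_i(N) ℓ_i(y) + g(y)`. This class contains the mirror forms
`Σ_i x_i x_{n−1−i}` (`h = n/2`; the named hard case stmt-1391 of the crux) and every
Maiorana–McFarland phase `⟨x, π(y)⟩ + g(y)` on the digit split, of any degree in the high variables.

Proof: regroup the sum over `N < 2ⁿ = 2^h · 2^{n−h}` by `y = ⌊N/2^h⌋` (`sum_range_mul_split`); on the
`y`-th interval the phase factorises as `(−1)^{P(bits(2^h y + x))} = (−1)^{g(y)} · w_{S_y}(x)` with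
`S_y = {i : ℓ_i(y) = 1}` (`sign_bilinear_eq_prod_filter`; the sign-character bookkeeping `sign_add`,
`sign_sum`, `sign_ite`, `abs_sign` is reused from the `QuadraticDigitPhases` line,
`Theorems/MobiusLadderQuadraticDigitPhasesStubOneCutKataiCS.lean`), so the inner sum has absolute value
`|Σ_{x<2^h} λ(2^h y + x) w_{S_y}(x)|`; sum over `y` (triangle inequality) and apply the hypothesis
with `σ = (y ↦ S_y)`. Pure finite sums; no named facts.
-/

namespace Summit.QuantumAdvantage.DigitPolyUniformity.SketchLAR

open Filter Finset
open Summit.QuantumAdvantage.DigitPolyUniformity.Sketch (sum_range_mul_split)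
open Summit.QuantumAdvantage.QuantumAdvantage.Theorems.MobiusLadderQuadraticDigitPhasesStubOneCutKatai
  (sign_add sign_sum sign_ite abs_sign)

namespace LowAffineOfShortWalsh

/-- The sign of one bilinear term `bit · v` (`bit ∈ {0,1}`, `v ∈ 𝔽₂`): it is the digit sign
`(−1)^{bit}` when `v = 1` and `1` when `v = 0`. [folklore] -/
theorem sign_bit_mul (b : Bool) (v : ZMod 2) :
    (if (if b then (1 : ZMod 2) else 0) * v = 1 then (-1 : ℝ) else 1) =
      if v = 1 then (if b then (-1 : ℝ) else 1) else 1 := by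
  have key : ∀ u : ZMod 2, u = 0 ∨ u = 1 := by decide
  rcases key v with rfl | rfl
  · rw [mul_zero, if_neg zero_ne_one, if_neg zero_ne_one]
  · rw [mul_one, sign_ite, if_pos rfl]

/-- **Factorisation of a low-affine phase.** For digits `b : ι → Bool`, coefficients `v : ι → 𝔽₂`
and a constant `u ∈ 𝔽₂`:
`(−1)^{[Σ_{i∈s} b_i v_i + u = 1]} = (−1)^{[u = 1]} · Π_{i ∈ s, v_i = 1} (−1)^{b_i}` — the phase of an
affine form is `±` the Walsh character on its support. [folklore] -/
theorem sign_bilinear_eq_prod_filter {ι : Type*} (s : Finset ι) (b : ι → Bool) (v : ι → ZMod 2)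
    (u : ZMod 2) :
    (if ∑ i ∈ s, (if b i then (1 : ZMod 2) else 0) * v i + u = 1 then (-1 : ℝ) else 1) =
      (if u = 1 then (-1 : ℝ) else 1) *
        ∏ i ∈ s.filter (fun i => v i = 1), (if b i then (-1 : ℝ) else 1) := by
  rw [sign_add, sign_sum, Finset.prod_filter, mul_comm]
  congr 1
  exact Finset.prod_congr rfl fun i _ => sign_bit_mul (b i) (v i)

/-- Splitting `N = 2^k y + x` with `x < 2^k`: the quotient by `2^k` is `y`. [folklore] -/
theorem two_pow_mul_add_div (k y : ℕ) {x : ℕ} (hx : x < 2 ^ k) : (2 ^ k * y + x) / 2 ^ k = y := by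
  rw [Nat.mul_add_div (Nat.two_pow_pos k), Nat.div_eq_of_lt hx, Nat.add_zero]

/-- Splitting `N = 2^k y + x` with `x < 2^k`: the low `k` digits of `N` are those of `x`. [folklore] -/
theorem testBit_two_pow_mul_add_of_lt (k y : ℕ) {x : ℕ} (hx : x < 2 ^ k) {i : ℕ} (hi : i < k) :
    Nat.testBit (2 ^ k * y + x) i = Nat.testBit x i := by
  rw [Nat.testBit_two_pow_mul_add y hx, if_pos hi]

/-- Splitting `N = 2^k y + x` with `x < 2^k`, `y < 2^{n−k}`, `k ≤ n`: then `N < 2ⁿ`. [folklore] -/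
theorem two_pow_mul_add_lt (n k y : ℕ) (hk : k ≤ n) {x : ℕ} (hx : x < 2 ^ k) (hy : y < 2 ^ (n - k)) :
    2 ^ k * y + x < 2 ^ n := by
  calc 2 ^ k * y + x < 2 ^ k * y + 2 ^ k := Nat.add_lt_add_left hx _
    _ = 2 ^ k * (y + 1) := by ring
    _ ≤ 2 ^ k * 2 ^ (n - k) := Nat.mul_le_mul_left _ hy
    _ = 2 ^ n := by rw [← pow_add, Nat.add_sub_cancel' hk]

end LowAffineOfShortWalsh

open LowAffineOfShortWalsh in
/-- **The low-affine class from averaged short-interval Walsh uniformity.** Fix a cut `h(n) ≤ n` and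
split `N = 2^{h} y + x` (`x` = the low `h` digits, `y` = the high ones). HYPOTHESIS (short-interval
Walsh uniformity at scale `2^{h(n)}`, on average over the aligned intervals, with the frequency allowed
to depend on the interval): for every `ε > 0`, eventually in `n`, for every selection
`σ : y ↦ S_y ⊆ {0..h−1}`, `Σ_{y < 2^{n−h}} |Σ_{x < 2^h} λ(2^h y + x) w_{S_y}(x)| ≤ ε 2ⁿ`. CONCLUSION:
the crux inequality for every `P` that is AFFINE IN THE LOW DIGITS with coefficients arbitrary
functions of the high digits, `P(bits N) = Σ_{i<h} bit_i(N) ℓ_i(y) + g(y)` — this class contains the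
mirror forms `Σ_i x_i x_{n−1−i}` (`h = n/2`) and every Maiorana–McFarland phase `⟨x, π(y)⟩ + g(y)` on
the digit split, of any degree in the high variables. Proof: group by `y`,
`χ_P(2^h y + x) = (−1)^{g(y)} w_{S_y}(x)` with `S_y = {i : ℓ_i(y) = 1}`, triangle inequality.
[folklore] -/
theorem digitPolyUniformity_lowAffine_of_shortWalsh (h : ℕ → ℕ) (hh : ∀ n, h n ≤ n)
    (hSIW : ∀ ε : ℝ, 0 < ε → ∀ᶠ n : ℕ in atTop, ∀ σ : ℕ → Finset (Fin (h n)),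
      ∑ y ∈ Finset.range (2 ^ (n - h n)),
        |∑ x ∈ Finset.range (2 ^ h n), ((ArithmeticFunction.liouville (2 ^ h n * y + x) : ℤ) : ℝ) *
            ∏ i ∈ σ y, (if Nat.testBit x i then (-1 : ℝ) else 1)| ≤ ε * (2 : ℝ) ^ n) :
    ∀ ε : ℝ, 0 < ε → ∀ᶠ n : ℕ in atTop, ∀ P : MvPolynomial (Fin n) (ZMod 2),
      (∃ ℓ : Fin (h n) → ℕ → ZMod 2, ∃ g : ℕ → ZMod 2, ∀ N : ℕ, N < 2 ^ n →
          MvPolynomial.eval (fun i : Fin n => if Nat.testBit N i then (1 : ZMod 2) else 0) P =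
            ∑ i : Fin (h n), (if Nat.testBit N i then (1 : ZMod 2) else 0) * ℓ i (N / 2 ^ h n) +
              g (N / 2 ^ h n)) →
        |∑ N ∈ Finset.range (2 ^ n), ((ArithmeticFunction.liouville N : ℤ) : ℝ) *
            (if MvPolynomial.eval (fun i : Fin n => if Nat.testBit N i then (1 : ZMod 2) else 0) P = 1
              then (-1 : ℝ) else 1)| ≤ ε * (2 : ℝ) ^ n := by
  intro ε hε
  filter_upwards [hSIW ε hε] with n hn
  rintro P ⟨ℓ, g, hP⟩
  -- the frequency selection `σ y = S_y = {i < h : ℓ_i(y) = 1}`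
  have key := hn (fun y => (Finset.univ : Finset (Fin (h n))).filter (fun i => ℓ i y = 1))
  -- regroup `N < 2ⁿ = 2^h · 2^{n−h}` as `N = 2^h y + x`
  have hsplit : (2 : ℕ) ^ n = 2 ^ h n * 2 ^ (n - h n) := by
    rw [← pow_add, Nat.add_sub_cancel' (hh n)]
  rw [hsplit, sum_range_mul_split]
  refine (Finset.abs_sum_le_sum_abs _ _).trans (le_of_eq_of_le (Finset.sum_congr rfl fun y hy => ?_) key)
  have hy : y < 2 ^ (n - h n) := Finset.mem_range.mp hy
  -- on the `y`-th interval the phase is `(−1)^{g y} · w_{S_y}(x)`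
  have hpt : ∀ x ∈ Finset.range (2 ^ h n),
      ((ArithmeticFunction.liouville (2 ^ h n * y + x) : ℤ) : ℝ) *
          (if MvPolynomial.eval (fun i : Fin n => if Nat.testBit (2 ^ h n * y + x) i then (1 : ZMod 2) else 0) P = 1
            then (-1 : ℝ) else 1) =
        (if g y = 1 then (-1 : ℝ) else 1) *
          (((ArithmeticFunction.liouville (2 ^ h n * y + x) : ℤ) : ℝ) *
            ∏ i ∈ (Finset.univ : Finset (Fin (h n))).filter (fun i => ℓ i y = 1),
              (if Nat.testBit x i then (-1 : ℝ) else 1)) := by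
    intro x hx
    have hx : x < 2 ^ h n := Finset.mem_range.mp hx
    rw [hP _ (two_pow_mul_add_lt n (h n) y (hh n) hx hy), two_pow_mul_add_div (h n) y hx,
      sign_bilinear_eq_prod_filter, mul_left_comm]
    congr 2
    exact Finset.prod_congr rfl fun i _ => by
      rw [testBit_two_pow_mul_add_of_lt (h n) y hx i.isLt]
  rw [Finset.sum_congr rfl hpt, ← Finset.mul_sum, abs_mul, abs_sign, one_mul]

end Summit.QuantumAdvantage.DigitPolyUniformity.SketchLAR
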